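/-
Q_C RE-TYPED, rider completed (rh-split cell, K-lane; seat rh-split-ref g13 = refuter acting as functional referee,
2026-08-28; sequel to lead RULING #512 landings #860 `Negative/IntegerWindowTheftAsTyped.lean` and #861
`Negative/PrimeWindowBlindnessQCRetyped.lean`).  Theory desk rider 25.33 (B), COMMON-ABSCISSA half, against the re-typed
question C′ = `IntegerWindowTheft'`: two DISTINCT hypothetical off-line nontrivial zeros `ρ ≠ ρ′` with
`Re ρ = Re ρ′ ∈ (1/2, 1/2 + σ*)` and `Im ρ, Im ρ′ > 0` make C′ TRUE at EVERY window (`κ₁ = ρ - 1/2`, `κ₂ = ρ′ - 1/2`,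
`m = 1`, theft `n = 1` on the two disjoint quadruples; the window identity is term-by-term, `sum_quadruple_window`).
With #861's double-zero half: `¬ C′(U, σ*)` at ONE window implies that the off-line zeros of the band in the upper
half-plane are SIMPLE and have PAIRWISE DISTINCT ABSCISSAE — the NO direction of Q_C′ is hypothesis-side content about
off-line zeros of `ζ`, not an RH-free statement; the RH-free residual question is C″ = `IntegerWindowTheftOnLine`.
Theorems only (proof lane); `--supports stmt-RiemannHypothesis-21693`; no `instance`, no notation, nothing `private`;
ζ enters only through the tree's zero set / multiplicity API; std axioms.  Nothing here bears on the truth of RH.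
-/
import Summits.RiemannHypothesis.RiemannHypothesis.Theorems.Splittings.Negative.PrimeWindowBlindnessQCRetyped
import Literature.NumberTheory.LFunctions.ZetaZerosProofs
import Literature.NumberTheory.LFunctions.ZetaZerosReflection
import HarnessLib

/-!
# Q_C′: two off-line zeros at a common abscissa steal themselves

* `quadruple_mem_nontrivialZeros` — the quadruple `{ρ, 1-ρ, ρ̄, 1-ρ̄}` of a nontrivial zero: nontrivial zeros of the same
  multiplicity;
* `sum_quadruple_window` — the exact window identity of one quadruple (`quadTerm_eq_sum_four`), every `t`;
* `integerWindowTheft'_of_two_offline_zeros` — the rider, common-abscissa half (C′ at every window `U`);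
* `offline_abscissae_distinct_of_not_integerWindowTheft'` — contrapositive: ¬C′ at one window ⇒ off-line zeros of the
  band in the upper half-plane with equal real parts coincide (companion of `offline_simple_of_not_integerWindowTheft'`).
-/

noncomputable section

set_option linter.dupNamespace false

open Complex Set
open scoped ComplexConjugate Real

namespace Summit.RiemannHypothesis.RiemannHypothesis.Theorems.Splittings.ScrewLatticeTower

open Summit.RiemannHypothesis.RiemannHypothesis.Theorems.Splittings.ScrewLatticeWolff
open Literature.NumberTheory.LFunctions

/-- A nontrivial zero has positive multiplicity. -/
theorem zeroOrder_pos_of_mem_nontrivialZeros {s : ℂ} (hs : s ∈ ZetaZeros.riemannZetaNontrivialZeros) :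
    0 < riemannZetaZeroOrder s := by
  have h := mem_riemannZetaNontrivialZeros_iff_holds.1 hs
  have hs1 : s ≠ 1 := fun h1 ↦ by
    have h2 := h.2.2
    rw [h1] at h2; simp at h2
  exact (riemannZetaZeroOrder_pos_iff hs1).2 h.1

/-- A point of the open critical strip of positive multiplicity is a nontrivial zero. -/
theorem mem_nontrivialZeros_of_zeroOrder_pos {s : ℂ} (h0 : 0 < s.re) (h1 : s.re < 1)
    (hm : 0 < riemannZetaZeroOrder s) : s ∈ ZetaZeros.riemannZetaNontrivialZeros := by
  have hs1 : s ≠ 1 := fun h ↦ by rw [h] at h1; simp at h1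
  exact mem_riemannZetaNontrivialZeros_iff_holds.2 ⟨(riemannZetaZeroOrder_pos_iff hs1).1 hm, h0, h1⟩

/-- The symmetric quadruple `{ρ, 1-ρ, ρ̄, 1-ρ̄}` of a nontrivial zero consists of nontrivial zeros of the same
multiplicity (`riemannZetaZeroOrder_conj_holds`, `riemannZetaZeroOrder_one_sub_holds`, `riemannZetaZeroOrder_one_sub_conj`). -/
theorem quadruple_mem_nontrivialZeros {ρ : ℂ} (hρ : ρ ∈ ZetaZeros.riemannZetaNontrivialZeros) :
    ∀ s ∈ ({ρ, 1 - ρ, conj ρ, 1 - conj ρ} : Finset ℂ),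
      s ∈ ZetaZeros.riemannZetaNontrivialZeros ∧ riemannZetaZeroOrder s = riemannZetaZeroOrder ρ := by
  have h := mem_riemannZetaNontrivialZeros_iff_holds.1 hρ
  have h0 : 0 < ρ.re := h.2.1
  have h1 : ρ.re < 1 := h.2.2
  have hm : 0 < riemannZetaZeroOrder ρ := zeroOrder_pos_of_mem_nontrivialZeros hρ
  have hmc : riemannZetaZeroOrder (conj ρ) = riemannZetaZeroOrder ρ := riemannZetaZeroOrder_conj_holds ρ
  have hm1 : riemannZetaZeroOrder (1 - ρ) = riemannZetaZeroOrder ρ := riemannZetaZeroOrder_one_sub_holds h0 h1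
  have hm1c : riemannZetaZeroOrder (1 - conj ρ) = riemannZetaZeroOrder ρ := riemannZetaZeroOrder_one_sub_conj h0 h1
  intro s hs
  simp only [Finset.mem_insert, Finset.mem_singleton] at hs
  rcases hs with rfl | rfl | rfl | rfl
  · exact ⟨hρ, rfl⟩
  · exact ⟨mem_nontrivialZeros_of_zeroOrder_pos (by simp; linarith) (by simp; linarith) (by rw [hm1]; exact hm), hm1⟩
  · exact ⟨mem_nontrivialZeros_of_zeroOrder_pos (by simp; linarith) (by simp; linarith) (by rw [hmc]; exact hm), hmc⟩
  · exact ⟨mem_nontrivialZeros_of_zeroOrder_pos (by simp; linarith) (by simp; linarith) (by rw [hm1c]; exact hm), hm1c⟩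

/-- The exact window identity of ONE quadruple (term-by-term, every `t`): the four Suzuki terms of
`{ρ, 1-ρ, ρ̄, 1-ρ̄}` with coefficient `c` sum to `c · quadTerm 1 (ρ - 1/2) t` (`quadTerm_eq_sum_four`). -/
theorem sum_quadruple_window {ρ : ℂ} (hre : ρ.re ≠ 1 / 2) (him : ρ.im ≠ 0) (c : ℂ) (t : ℝ) :
    ∑ s ∈ ({ρ, 1 - ρ, conj ρ, 1 - conj ρ} : Finset ℂ),
        c * ((Complex.cosh ((s - 1 / 2) * t) - 1) / (s - 1 / 2) ^ 2)
      = c * ((quadTerm 1 (ρ - 1 / 2) t : ℝ) : ℂ) := by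
  have ne12 : ρ ≠ 1 - ρ := fun h ↦ by
    have := congrArg Complex.re h
    simp only [Complex.sub_re, Complex.one_re] at this; apply hre; linarith
  have ne13 : ρ ≠ conj ρ := fun h ↦ by
    have := congrArg Complex.im h
    simp only [Complex.conj_im] at this; apply him; linarith
  have ne14 : ρ ≠ 1 - conj ρ := fun h ↦ by
    have := congrArg Complex.re h
    simp only [Complex.sub_re, Complex.one_re, Complex.conj_re] at this; apply hre; linarith
  have ne23 : 1 - ρ ≠ conj ρ := fun h ↦ by
    have := congrArg Complex.re h
    simp only [Complex.sub_re, Complex.one_re, Complex.conj_re] at this; apply hre; linarith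
  have ne24 : 1 - ρ ≠ 1 - conj ρ := fun h ↦ by
    have := congrArg Complex.im h
    simp only [Complex.sub_im, Complex.one_im, Complex.conj_im] at this; apply him; linarith
  have ne34 : conj ρ ≠ 1 - conj ρ := fun h ↦ by
    have := congrArg Complex.re h
    simp only [Complex.sub_re, Complex.one_re, Complex.conj_re] at this; apply hre; linarith
  have hA : ρ ∉ ({1 - ρ, conj ρ, 1 - conj ρ} : Finset ℂ) := by
    simp only [Finset.mem_insert, Finset.mem_singleton, not_or]; exact ⟨ne12, ne13, ne14⟩
  have hB : 1 - ρ ∉ ({conj ρ, 1 - conj ρ} : Finset ℂ) := by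
    simp only [Finset.mem_insert, Finset.mem_singleton, not_or]; exact ⟨ne23, ne24⟩
  have hC : conj ρ ∉ ({1 - conj ρ} : Finset ℂ) := by
    simp only [Finset.mem_singleton]; exact ne34
  have e1 : (1 : ℂ) - ρ - 1 / 2 = -(ρ - 1 / 2) := by ring
  have e2 : conj (ρ - 1 / 2) = conj ρ - 1 / 2 := by
    apply Complex.ext <;> simp
  have e3 : (1 : ℂ) - conj ρ - 1 / 2 = -conj (ρ - 1 / 2) := by rw [e2]; ring
  rw [Finset.sum_insert hA, Finset.sum_insert hB, Finset.sum_insert hC, Finset.sum_singleton,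
    quadTerm_eq_sum_four, e3, e1, ← e2]
  push_cast
  ring

/-- **Two off-line zeros at a common abscissa steal themselves** (theory desk rider 25.33 (B), common-abscissa half):
if `ζ` had two DISTINCT nontrivial zeros `ρ ≠ ρ′` with `Re ρ = Re ρ′ ∈ (1/2, 1/2 + σ*)` and `Im ρ, Im ρ′ > 0`, then C′
holds at EVERY window `U` — the single-index configuration `κ₁ = ρ - 1/2`, `κ₂ = ρ′ - 1/2`, `m = 1`, with theft `n = 1`
on the two (disjoint) quadruples; the window identity is `sum_quadruple_window` twice, at every `t`. -/
theorem integerWindowTheft'_of_two_offline_zeros {σs : ℝ} {ρ ρ' : ℂ}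
    (hρ : ρ ∈ ZetaZeros.riemannZetaNontrivialZeros) (hρ' : ρ' ∈ ZetaZeros.riemannZetaNontrivialZeros)
    (h₀ : 1 / 2 < ρ.re) (hσ : ρ.re < 1 / 2 + σs) (hre : ρ'.re = ρ.re) (hγ : 0 < ρ.im) (hγ' : 0 < ρ'.im)
    (hne : ρ ≠ ρ') (U : ℝ) : IntegerWindowTheft' U σs := by
  classical
  set S : Finset ℂ := {ρ, 1 - ρ, conj ρ, 1 - conj ρ} with hS
  set T : Finset ℂ := {ρ', 1 - ρ', conj ρ', 1 - conj ρ'} with hT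
  have memS : ∀ s : ℂ, s ∈ S ↔ s = ρ ∨ s = 1 - ρ ∨ s = conj ρ ∨ s = 1 - conj ρ := by
    intro s; simp [hS]
  have memT : ∀ s : ℂ, s ∈ T ↔ s = ρ' ∨ s = 1 - ρ' ∨ s = conj ρ' ∨ s = 1 - conj ρ' := by
    intro s; simp [hT]
  have hSsub : ∀ s ∈ S, s ∈ ZetaZeros.riemannZetaNontrivialZeros := fun s hs ↦
    (quadruple_mem_nontrivialZeros hρ s (by rw [hS] at hs; exact hs)).1
  have hTsub : ∀ s ∈ T, s ∈ ZetaZeros.riemannZetaNontrivialZeros := fun s hs ↦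
    (quadruple_mem_nontrivialZeros hρ' s (by rw [hT] at hs; exact hs)).1
  -- the two quadruples are disjoint (16 sign / injectivity checks)
  have hdisj : Disjoint S T := by
    rw [Finset.disjoint_left]
    intro s hsS hsT
    rcases (memS s).1 hsS with rfl | rfl | rfl | rfl <;>
      rcases (memT _).1 hsT with h | h | h | h <;>
      · have hr := congrArg Complex.re h
        have hi := congrArg Complex.im h
        try simp only [Complex.sub_re, Complex.one_re, Complex.conj_re, Complex.sub_im, Complex.one_im,
          Complex.conj_im] at hr hi
        exact hne (Complex.ext (by linarith) (by linarith))
  refine ⟨⟨Unit, fun _ ↦ 1, fun _ ↦ 1, fun _ ↦ ρ - 1 / 2, fun _ ↦ ρ' - 1 / 2⟩,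
    fun s ↦ (if s ∈ S then 1 else 0) + (if s ∈ T then 1 else 0), ⟨()⟩, fun _ ↦ ⟨rfl, rfl⟩,
    fun _ ↦ ⟨?_, ?_, ?_⟩, fun _ ↦ ⟨Set.toFinite _, Set.toFinite _⟩, (hasSum_fintype _).summable, ?_, ?_, ?_⟩
  · simp; linarith
  · simp; linarith
  · simp only [Complex.sub_re, hre]
  · -- clause 6′: `n ≤ m` on the nontrivial zeros
    intro s hs
    have hms : 0 < riemannZetaZeroOrder s := zeroOrder_pos_of_mem_nontrivialZeros hs
    by_cases hS' : s ∈ S <;> by_cases hT' : s ∈ T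
    · exact absurd hT' (Finset.disjoint_left.1 hdisj hS')
    · beta_reduce; rw [if_pos hS', if_neg hT']; push_cast; omega
    · beta_reduce; rw [if_neg hS', if_pos hT']; push_cast; omega
    · beta_reduce; rw [if_neg hS', if_neg hT']; push_cast; omega
  · -- clause 7: no theft off the nontrivial zeros
    intro s hs
    have hS' : s ∉ S := fun h ↦ hs (hSsub s h)
    have hT' : s ∉ T := fun h ↦ hs (hTsub s h)
    simp [hS', hT']
  · -- clause 8: the exact window identity, at every `t`
    intro t _ht
    set g : ℂ → ℂ := fun s ↦ (((if s ∈ S then 1 else 0) + (if s ∈ T then 1 else 0) : ℕ) : ℂ) *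
      ((Complex.cosh ((s - 1 / 2) * t) - 1) / (s - 1 / 2) ^ 2) with hg
    have hsupp : Function.support g ⊆ ZetaZeros.riemannZetaNontrivialZeros := by
      intro s hs
      by_contra hnz
      apply hs
      simp only [hg]
      rw [if_neg (fun h ↦ hnz (hSsub s h)), if_neg (fun h ↦ hnz (hTsub s h))]
      simp
    refine (hasSum_subtype_iff_indicator (f := g)).2 ?_
    rw [Set.indicator_eq_self.2 hsupp]
    have hpsi : Config.psi ⟨Unit, fun _ ↦ 1, fun _ ↦ 1, fun _ ↦ ρ - 1 / 2, fun _ ↦ ρ' - 1 / 2⟩ t =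
        quadTerm 1 (ρ - 1 / 2) t + quadTerm 1 (ρ' - 1 / 2) t := by
      simp [Config.psi, modelPsi, tsum_fintype]
    have hgS : ∀ b ∈ S, g b = 1 * ((Complex.cosh ((b - 1 / 2) * t) - 1) / (b - 1 / 2) ^ 2) := by
      intro b hb
      simp only [hg]
      rw [if_pos hb, if_neg (Finset.disjoint_left.1 hdisj hb)]
      push_cast; ring
    have hgT : ∀ b ∈ T, g b = 1 * ((Complex.cosh ((b - 1 / 2) * t) - 1) / (b - 1 / 2) ^ 2) := by
      intro b hb
      simp only [hg]
      rw [if_neg (Finset.disjoint_right.1 hdisj hb), if_pos hb]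
      push_cast; ring
    have hρre : ρ.re ≠ 1 / 2 := by linarith
    have hρ're : ρ'.re ≠ 1 / 2 := by rw [hre]; linarith
    have hval : ∑ b ∈ S ∪ T, g b = ((Config.psi ⟨Unit, fun _ ↦ 1, fun _ ↦ 1, fun _ ↦ ρ - 1 / 2,
        fun _ ↦ ρ' - 1 / 2⟩ t : ℝ) : ℂ) := by
      rw [Finset.sum_union hdisj, Finset.sum_congr rfl hgS, Finset.sum_congr rfl hgT, hS, hT,
        sum_quadruple_window hρre hγ.ne' 1 t, sum_quadruple_window hρ're hγ'.ne' 1 t, hpsi, Complex.ofReal_add]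
      ring
    rw [← hval]
    exact hasSum_sum_of_ne_finset_zero (fun b hb ↦ by
      rw [Finset.mem_union, not_or] at hb
      simp only [hg]
      rw [if_neg hb.1, if_neg hb.2]
      simp)

/-- **Contrapositive (common-abscissa half).**  If C′ fails at some window `U`, then two off-line nontrivial zeros of the
band `1/2 < Re < 1/2 + σ*` in the upper half-plane with the SAME real part coincide: together with
`offline_simple_of_not_integerWindowTheft'`, ¬C′ at one window says the off-line zeros of the band are simple with
pairwise distinct abscissae — hypothesis-side content about off-line zeros. -/
theorem offline_abscissae_distinct_of_not_integerWindowTheft' {U σs : ℝ} (h : ¬ IntegerWindowTheft' U σs)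
    {ρ ρ' : ℂ} (hρ : ρ ∈ ZetaZeros.riemannZetaNontrivialZeros) (hρ' : ρ' ∈ ZetaZeros.riemannZetaNontrivialZeros)
    (h₀ : 1 / 2 < ρ.re) (hσ : ρ.re < 1 / 2 + σs) (hre : ρ'.re = ρ.re) (hγ : 0 < ρ.im) (hγ' : 0 < ρ'.im) :
    ρ = ρ' := by
  by_contra hne
  exact h (integerWindowTheft'_of_two_offline_zeros hρ hρ' h₀ hσ hre hγ hγ' hne U)

end Summit.RiemannHypothesis.RiemannHypothesis.Theorems.Splittings.ScrewLatticeTower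

end
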